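import Mathlib
import Literature.AlgebraicGeometry.Resolution.CobordantGame
import Literature.AlgebraicGeometry.Resolution.CobordantChartCoefficients
import Literature.AlgebraicGeometry.Resolution.CobordantChartPlaneSlice
import Literature.AlgebraicGeometry.Resolution.AxisPolyhedron
import Summits.ResolutionOfSingularities.ResolutionOfSingularities.Theorems.WeightedInvariantLocalWeightedDropAxisWeightedMoveCone
import Summits.ResolutionOfSingularities.ResolutionOfSingularities.Theorems.WeightedInvariantLocalWeightedDropAxisWeightedMoveTranslate

/-!
# `WeightedInvariant.LocalWeightedDrop`, line `hasse-ridge-face-selection`: the weighted move (B2), part 3 —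
# the `z`-slot slice at the axis point of the exceptional divisor

Crux item stmt-ResolutionOfSingularities-8899 (route `ResolutionOfSingularities/WeightedInvariant`), skeleton v18 of
the line `hasse-ridge-face-selection`, helpers toward stub `stub_axisWeightedMove` (B2).

The weighted move `(X, (m, …, m, 1))` from an axis germ `g` of order `d` above the level `m`, at the AXIS POINT
`c = (0, …, 0, c_z)`, `c_z ≠ 0`, of the exceptional divisor: `g(chart) = s^{md} · G`, and the tame slice (weight `1`)
`Sl := G|_{y_z = 0} ∈ k[[s, y'₁, …, y'ₙ]]` (`s = X 0`, `y'_j = X j.succ`).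
* `coeff_slice` — `coeff (s^r y'^b) Sl = g_{(b, md + r - m|b|)} c_z^{md + r - m|b|}` (and `0` if `m|b| > md + r`):
  the monomial `x'^b z^e` of `g` becomes `g_{b,e} c_z^e s^{m|b| + e - md} y'^b`;
* `order_slice_lt` — if `δ(g) < m + 1` (a monomial with `e < (m+1)(d - |b|)`), then `ord Sl < d`;
* `le_order_slice`, `order_slice_eq`, `isSingular_slice` — if `δ(g) ≥ m + 1`, then `Sl` is singular of order `d`;
* `initEval_slice` — its degree-`d` form is `Γ(s, y') = F(y') + Σ_{|b| < d} g_{(b,(m+1)(d-|b|))} c_z^{(m+1)(d-|b|)} s^{d-|b|} y'^b`;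
* `apexFree_slice` — if moreover the level-`(m+1)` line of `g` is NON-EMPTY, `g` has trivial apex inside `z = 0`
  and is prepared, then `Γ` has NO non-zero translation-invariance vector (`k` infinite): a vector `(0, u')` would
  put `u'` in the apex of `F`; a vector `(u_s, u')`, `u_s ≠ 0`, gives `Γ(1, y') = F(y' - u'/u_s)` (invariance under
  all multiples by homogeneity), i.e. `-u'/(u_s c_z^{m+1})` solves the level-`(m+1)` vertex (`solvable_of_eval`) —
  excluded by `PreparedAxis` if `u' ≠ 0`, and forcing the level-`(m+1)` line to be empty if `u' = 0`.
-/

set_option linter.dupNamespace false -- mandated namespace of this single-conjunct summit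

namespace Summit.ResolutionOfSingularities.ResolutionOfSingularities.Theorems

open Literature.AlgebraicGeometry.Resolution

namespace AxisWeightedMove

variable {k : Type} [Field k] {n : ℕ}

/-! ### The `z`-slot slice at the axis point -/

section AxisPoint

variable {w : Fin (n + 1) → ℕ} {m : ℕ} (hw1 : w (Fin.last n) = 1) (hwm : ∀ j, w (Fin.castSucc j) = m)
  (hm : 1 ≤ m) {d : ℕ} {g : MvPowerSeries (Fin (n + 1)) k} {c : Fin (n + 1) → k}
  {G : MvPowerSeries (Fin (n + 2)) k}
  (hfac : MvPowerSeries.subst (CobordantChart.chart w c) g = MvPowerSeries.X 0 ^ (m * d) * G)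
  (hc' : ∀ j : Fin n, c (Fin.castSucc j) = 0)

include hc' in
/-- With `c' = 0` the Taylor factor of an exponent `D` against `(b, 0)` vanishes unless `D' = b`. -/
theorem prod_eq_zero_of_xPart_ne {D : Fin (n + 1) →₀ ℕ} {b : Fin n →₀ ℕ} (h : ∃ j : Fin n, D (Fin.castSucc j) ≠ b j) :
    ∏ i : Fin (n + 1), (((D i).choose ((Finsupp.equivFunOnFinite.symm (Fin.snoc (⇑b) 0 : Fin (n + 1) → ℕ)) i) : k) *
      c i ^ (D i - (Finsupp.equivFunOnFinite.symm (Fin.snoc (⇑b) 0 : Fin (n + 1) → ℕ)) i)) = 0 := by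
  obtain ⟨j, hj⟩ := h
  refine Finset.prod_eq_zero (Finset.mem_univ (Fin.castSucc j)) ?_
  rw [snoc_castSucc, hc' j]
  rcases lt_or_gt_of_ne hj with hlt | hgt
  · rw [Nat.choose_eq_zero_of_lt hlt, Nat.cast_zero, zero_mul]
  · rw [zero_pow (Nat.sub_ne_zero_of_lt hgt), mul_zero]

include hw1 hwm hm hfac hc' in
/-- COEFFICIENTS OF THE `z`-SLOT SLICE AT THE AXIS POINT: `coeff (s^r y'^b) (G|_{y_z = 0}) = g_{(b, e)} c_z^e` with
`e = md + r - m|b|` (the unique exponent of `w`-weight `md + r` over `b`), and `0` if `m|b| > md + r`. -/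
theorem coeff_slice (r : ℕ) (b : Fin n →₀ ℕ) :
    MvPowerSeries.coeff (Finsupp.cons r b) (MvPowerSeries.subst (fun j : Fin (n + 2) =>
        if j = (Fin.last n).succ then (0 : MvPowerSeries (Fin (n + 1)) k)
        else MvPowerSeries.X (Fin.predAbove (Fin.last n) j)) G) =
      if m * b.degree ≤ m * d + r then
        MvPowerSeries.coeff (Finsupp.equivFunOnFinite.symm
            (Fin.snoc (⇑b) (m * d + r - m * b.degree) : Fin (n + 1) → ℕ)) g *
          c (Fin.last n) ^ (m * d + r - m * b.degree)
      else 0 := by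
  have hconv : ∀ i, w i = 0 → c i = 0 := fun i hi => absurd hi (weight_pos hw1 hwm hm i).ne'
  have hsa : (Fin.last n).succ.succAbove = (Fin.castSucc : Fin (n + 1) → Fin (n + 2)) := Fin.succAbove_last
  rw [CobordantChartPlaneSlice.coeff_subst_slice (Fin.last n) G, hsa, mapDomain_castSucc_cons_eq,
    CobordantChart.coeff_cons_of_eq_X_pow_mul hfac, CobordantChart.coeff_subst_chart w c hconv]
  -- an exponent of weight `md + r` over `b` is `(b, md + r - m|b|)`
  have hkey : ∀ D : Fin (n + 1) →₀ ℕ, Finsupp.weight w D = m * d + r → (∀ j : Fin n, D (Fin.castSucc j) = b j) →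
      m * b.degree ≤ m * d + r ∧
        D = Finsupp.equivFunOnFinite.symm (Fin.snoc (⇑b) (m * d + r - m * b.degree) : Fin (n + 1) → ℕ) := by
    intro D hwD hD
    rw [weight_eq hw1 hwm] at hwD
    have hx : AxisPolyhedron.xDeg D = b.degree := by
      rw [AxisPolyhedron.xDeg, Finsupp.degree_eq_sum]
      exact Finset.sum_congr rfl fun j _ => hD j
    rw [hx] at hwD
    refine ⟨by omega, ?_⟩
    ext i
    refine Fin.lastCases ?_ (fun j => ?_) i
    · rw [snoc_last]; omega
    · rw [snoc_castSucc]; exact hD j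
  by_cases hle : m * b.degree ≤ m * d + r
  · rw [if_pos hle, finsum_eq_single _
      (Finsupp.equivFunOnFinite.symm (Fin.snoc (⇑b) (m * d + r - m * b.degree) : Fin (n + 1) → ℕ))]
    · rw [if_pos (by rw [weight_eq hw1 hwm, xDeg_snoc, snoc_last]; omega), Fin.prod_univ_castSucc]
      simp only [snoc_castSucc, snoc_last, Nat.choose_self, Nat.sub_self, pow_zero, Nat.cast_one, mul_one,
        Finset.prod_const_one, one_mul, Nat.choose_zero_right, Nat.sub_zero]
    · intro D hD
      split_ifs with hwD
      · by_cases hx : ∃ j : Fin n, D (Fin.castSucc j) ≠ b j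
        · rw [prod_eq_zero_of_xPart_ne hc' hx, mul_zero]
        · push Not at hx
          exact absurd (hkey D hwD hx).2 hD
      · rfl
  · rw [if_neg hle]
    refine finsum_eq_zero_of_forall_eq_zero fun D => ?_
    split_ifs with hwD
    · by_cases hx : ∃ j : Fin n, D (Fin.castSucc j) ≠ b j
      · rw [prod_eq_zero_of_xPart_ne hc' hx, mul_zero]
      · push Not at hx
        exact absurd (hkey D hwD hx).1 hle
    · rfl

include hw1 hwm hm hfac hc' in
/-- The coefficient of the slice at `(m|a| + e - md, a)` for a monomial `x'^a z^e` of `w`-weight `≥ md` is `g_{(a,e)} c_z^e`. -/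
theorem coeff_slice_of (E : Fin (n + 1) →₀ ℕ) (hE : m * d ≤ m * AxisPolyhedron.xDeg E + E (Fin.last n)) :
    MvPowerSeries.coeff (Finsupp.cons (m * AxisPolyhedron.xDeg E + E (Fin.last n) - m * d)
        (Finsupp.equivFunOnFinite.symm fun j : Fin n => E (Fin.castSucc j)))
      (MvPowerSeries.subst (fun j : Fin (n + 2) =>
        if j = (Fin.last n).succ then (0 : MvPowerSeries (Fin (n + 1)) k)
        else MvPowerSeries.X (Fin.predAbove (Fin.last n) j)) G) =
      MvPowerSeries.coeff E g * c (Fin.last n) ^ E (Fin.last n) := by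
  rw [coeff_slice hw1 hwm hm hfac hc', ← xDeg_eq_degree_xPart, if_pos (by omega),
    show m * d + (m * AxisPolyhedron.xDeg E + E (Fin.last n) - m * d) - m * AxisPolyhedron.xDeg E = E (Fin.last n) by
      omega, snoc_xPart]

include hw1 hwm hm hfac hc' in
/-- THE SLICE DROPS BELOW `d` WHEN `δ(g) < m + 1`: a monomial `x'^a z^e` with `|a| < d`,
`m(d - |a|) ≤ e < (m+1)(d - |a|)` gives the monomial `s^{m|a| + e - md} y'^a` of `Sl` of degree `< d`. -/
theorem order_slice_lt (hcz : c (Fin.last n) ≠ 0) (hlev : AxisPolyhedron.AboveLevel d m 1 g)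
    {E : Fin (n + 1) →₀ ℕ} (hEx : AxisPolyhedron.xDeg E < d) (hEg : MvPowerSeries.coeff E g ≠ 0)
    (hEz : E (Fin.last n) < (m + 1) * (d - AxisPolyhedron.xDeg E)) :
    (MvPowerSeries.subst (fun j : Fin (n + 2) =>
        if j = (Fin.last n).succ then (0 : MvPowerSeries (Fin (n + 1)) k)
        else MvPowerSeries.X (Fin.predAbove (Fin.last n) j)) G).order < (d : ℕ∞) := by
  have hge : m * (d - AxisPolyhedron.xDeg E) ≤ E (Fin.last n) := by
    by_contra hlt
    push Not at hlt
    exact hEg (hlev E hEx (by rw [one_mul]; exact hlt))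
  have hsplit : m * d = m * AxisPolyhedron.xDeg E + m * (d - AxisPolyhedron.xDeg E) := by
    rw [← Nat.mul_add, Nat.add_sub_cancel' hEx.le]
  have hmd : m * d ≤ m * AxisPolyhedron.xDeg E + E (Fin.last n) := by omega
  have hne := (coeff_slice_of hw1 hwm hm hfac hc' E hmd).trans_ne (mul_ne_zero hEg (pow_ne_zero _ hcz))
  refine lt_of_le_of_lt (MvPowerSeries.order_le hne) ?_
  rw [Literature.NumberTheory.Transcendental.NguyenRoy.degree_cons_eq, ← xDeg_eq_degree_xPart]
  have h3 : (m + 1) * (d - AxisPolyhedron.xDeg E) = m * (d - AxisPolyhedron.xDeg E) + (d - AxisPolyhedron.xDeg E) := by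
    ring
  exact_mod_cast (show m * AxisPolyhedron.xDeg E + E (Fin.last n) - m * d + AxisPolyhedron.xDeg E < d by omega)

include hw1 hwm hm hfac hc' in
/-- ABOVE THE LEVEL `m + 1` THE SLICE HAS ORDER `≥ d`: a monomial `s^r y'^b` of `Sl` with `r + |b| < d` comes from
`x'^b z^e` with `e = m(d - |b|) + r < (m+1)(d - |b|)`, which is absent. -/
theorem le_order_slice (hlev1 : AxisPolyhedron.AboveLevel d (m + 1) 1 g) :
    (d : ℕ∞) ≤ (MvPowerSeries.subst (fun j : Fin (n + 2) =>
        if j = (Fin.last n).succ then (0 : MvPowerSeries (Fin (n + 1)) k)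
        else MvPowerSeries.X (Fin.predAbove (Fin.last n) j)) G).order := by
  refine MvPowerSeries.nat_le_order fun e he => ?_
  rw [← Finsupp.cons_tail e, Literature.NumberTheory.Transcendental.NguyenRoy.degree_cons_eq] at he
  have h1 : e 0 + (Finsupp.tail e).degree < d := by exact_mod_cast he
  rw [← Finsupp.cons_tail e, coeff_slice hw1 hwm hm hfac hc']
  split_ifs with hle
  · have hbd : (Finsupp.tail e).degree < d := by omega
    have h2 : m * d = m * (Finsupp.tail e).degree + m * (d - (Finsupp.tail e).degree) := by
      rw [← Nat.mul_add, Nat.add_sub_cancel' hbd.le]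
    have h3 : (m + 1) * (d - (Finsupp.tail e).degree) =
        m * (d - (Finsupp.tail e).degree) + (d - (Finsupp.tail e).degree) := by
      ring
    rw [hlev1 _ (by rw [xDeg_snoc]; exact hbd) (by rw [xDeg_snoc, snoc_last, one_mul]; omega), zero_mul]
  · rfl

include hw1 hwm hm hfac hc' in
/-- The pure-`y'` coefficients of the slice in degree `d` are those of the form `F`: `coeff (y'^b) Sl = g_{(b, 0)}` for `|b| = d`. -/
theorem coeff_slice_top {b : Fin n →₀ ℕ} (hb : b.degree = d) :
    MvPowerSeries.coeff (Finsupp.cons 0 b) (MvPowerSeries.subst (fun j : Fin (n + 2) =>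
        if j = (Fin.last n).succ then (0 : MvPowerSeries (Fin (n + 1)) k)
        else MvPowerSeries.X (Fin.predAbove (Fin.last n) j)) G) =
      MvPowerSeries.coeff (Finsupp.equivFunOnFinite.symm (Fin.snoc (⇑b) 0 : Fin (n + 1) → ℕ)) g := by
  rw [coeff_slice hw1 hwm hm hfac hc', if_pos (by rw [hb]; omega), hb, add_zero, Nat.sub_self, pow_zero, mul_one]

include hw1 hwm hm hfac hc' in
/-- ABOVE THE LEVEL `m + 1` THE SLICE HAS ORDER EXACTLY `d` (the form `F ≠ 0` survives: `AxisCone`, `ord g = d`). -/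
theorem order_slice_eq (hlev1 : AxisPolyhedron.AboveLevel d (m + 1) 1 g) (hcone : AxisPolyhedron.AxisCone d g)
    (hgd : g.order = d) (hg : g ≠ 0) :
    (MvPowerSeries.subst (fun j : Fin (n + 2) =>
        if j = (Fin.last n).succ then (0 : MvPowerSeries (Fin (n + 1)) k)
        else MvPowerSeries.X (Fin.predAbove (Fin.last n) j)) G).order = d := by
  refine le_antisymm ?_ (le_order_slice hw1 hwm hm hfac hc' hlev1)
  obtain ⟨E, hE, hEd⟩ := MvPowerSeries.exists_coeff_ne_zero_and_order
    ((MvPowerSeries.ne_zero_iff_order_finite).mp hg)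
  rw [hgd, Nat.cast_inj] at hEd
  have hEz : E (Fin.last n) = 0 := by
    by_contra h
    exact hE (hcone E hEd h)
  have hxd : (Finsupp.equivFunOnFinite.symm fun j : Fin n => E (Fin.castSucc j)).degree = d := by
    rw [← xDeg_eq_degree_xPart]
    rw [AxisMove.degree_eq_xDeg_add, hEz, add_zero] at hEd
    exact hEd
  have hne : MvPowerSeries.coeff (Finsupp.cons 0 (Finsupp.equivFunOnFinite.symm fun j : Fin n => E (Fin.castSucc j)))
      (MvPowerSeries.subst (fun j : Fin (n + 2) =>
        if j = (Fin.last n).succ then (0 : MvPowerSeries (Fin (n + 1)) k)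
        else MvPowerSeries.X (Fin.predAbove (Fin.last n) j)) G) ≠ 0 := by
    rw [coeff_slice_top hw1 hwm hm hfac hc' hxd, ← hEz, snoc_xPart]
    exact hE
  refine (MvPowerSeries.order_le hne).trans ?_
  rw [Literature.NumberTheory.Transcendental.NguyenRoy.degree_cons_eq, hxd, zero_add]

include hw1 hwm hm hfac hc' in
/-- … so it is a singular germ (`d ≥ 2`). -/
theorem isSingular_slice (hlev1 : AxisPolyhedron.AboveLevel d (m + 1) 1 g) (hcone : AxisPolyhedron.AxisCone d g)
    (hgd : g.order = d) (hg : g ≠ 0) (hd2 : 2 ≤ d) :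
    CobordantGame.IsSingular k (MvPowerSeries.subst (fun j : Fin (n + 2) =>
        if j = (Fin.last n).succ then (0 : MvPowerSeries (Fin (n + 1)) k)
        else MvPowerSeries.X (Fin.predAbove (Fin.last n) j)) G) := by
  have hord := order_slice_eq hw1 hwm hm hfac hc' hlev1 hcone hgd hg
  refine ⟨fun h0 => ?_, (FormalCoordChange.two_le_order_iff _).mp ?_⟩
  · rw [h0, MvPowerSeries.order_zero] at hord
    exact ENat.top_ne_coe d hord
  · rw [hord]
    exact_mod_cast hd2

include hw1 hwm hm hfac hc' in
/-- THE DEGREE-`d` FORM OF THE SLICE: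
`in_d Sl (s, y') = Σ_{|b| ≤ d} g_{(b,(m+1)(d-|b|))} c_z^{(m+1)(d-|b|)} s^{d-|b|} y'^b`. -/
theorem initEval_slice (v : Fin (n + 1) → k) :
    CobordantChart.initEval (fun _ : Fin (n + 1) => 1) v d (MvPowerSeries.subst (fun j : Fin (n + 2) =>
        if j = (Fin.last n).succ then (0 : MvPowerSeries (Fin (n + 1)) k)
        else MvPowerSeries.X (Fin.predAbove (Fin.last n) j)) G) =
      ∑ b ∈ (Finset.range (d + 1)).biUnion (fun r => (Finset.univ : Finset (Fin n)).finsuppAntidiag r),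
        MvPowerSeries.coeff (Finsupp.equivFunOnFinite.symm
            (Fin.snoc (⇑b) ((m + 1) * (d - b.degree)) : Fin (n + 1) → ℕ)) g * c (Fin.last n) ^ ((m + 1) * (d - b.degree)) *
          (v 0 ^ (d - b.degree) * ∏ j, v j.succ ^ b j) := by
  rw [CobordantChart.initEval, finsum_eq_sum_cons
    ((Finset.range (d + 1)).biUnion (fun r => (Finset.univ : Finset (Fin n)).finsuppAntidiag r))
    (fun b => d - b.degree) _ ?_]
  · refine Finset.sum_congr rfl fun b hb => ?_
    rw [mem_belowSucc_iff] at hb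
    have he : m * d + (d - b.degree) - m * b.degree = (m + 1) * (d - b.degree) := by
      have : m * d = m * b.degree + m * (d - b.degree) := by rw [← Nat.mul_add, Nat.add_sub_cancel' hb]
      rw [this, Nat.add_mul, one_mul]
      omega
    have hle : m * b.degree ≤ m * d + (d - b.degree) := le_trans (Nat.mul_le_mul_left m hb) (Nat.le_add_right _ _)
    rw [if_pos (by rw [ApexFreeOrderDrop.weight_one_eq_degree, Literature.NumberTheory.Transcendental.NguyenRoy.degree_cons_eq]; omega),
      coeff_slice hw1 hwm hm hfac hc', if_pos hle, Fin.prod_univ_succ, Finsupp.cons_zero, he]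
    simp only [Finsupp.cons_succ]
  · intro e he
    have hw : Finsupp.weight (fun _ : Fin (n + 1) => 1) e = d := by
      by_contra h
      exact he (if_neg h)
    rw [ApexFreeOrderDrop.weight_one_eq_degree, ← Finsupp.cons_tail e, Literature.NumberTheory.Transcendental.NguyenRoy.degree_cons_eq] at hw
    refine ⟨(mem_belowSucc_iff d _).mpr (by omega), ?_⟩
    show e 0 = d - (Finsupp.tail e).degree
    omega

include hw1 hwm hm hfac hc' in
/-- On the hyperplane `s = 0` the degree-`d` form of the slice is the form `F` of `g`: `in_d Sl (0, v') = in_d g (v', 0)`. -/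
theorem initEval_slice_cons_zero (hcone : AxisPolyhedron.AxisCone d g) (v' : Fin n → k) :
    CobordantChart.initEval (fun _ : Fin (n + 1) => 1) (Fin.cons 0 v' : Fin (n + 1) → k) d
        (MvPowerSeries.subst (fun j : Fin (n + 2) =>
          if j = (Fin.last n).succ then (0 : MvPowerSeries (Fin (n + 1)) k)
          else MvPowerSeries.X (Fin.predAbove (Fin.last n) j)) G) =
      CobordantChart.initEval (fun _ : Fin (n + 1) => 1) (Fin.snoc v' 0 : Fin (n + 1) → k) d g := by
  rw [initEval_slice hw1 hwm hm hfac hc', initEval_snoc_zero hcone, sum_belowSucc]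
  refine Eq.trans (congrArg₂ (· + ·) (Finset.sum_congr rfl fun b hb => ?_)
    (Finset.sum_eq_zero fun b hb => ?_)) (add_zero _)
  · rw [mem_antidiag_iff_degree] at hb
    simp only [hb, Nat.sub_self, mul_zero, pow_zero, mul_one, Fin.cons_zero, one_mul, Fin.cons_succ]
  · rw [mem_below_iff] at hb
    rw [Fin.cons_zero, zero_pow (by omega), zero_mul, mul_zero]

include hw1 hwm hm hfac hc' in
/-- THE SLICE IS APEX-FREE when the level-`(m+1)` line of `g` is non-empty (`k` infinite; `g` above the level
`m + 1`, with `AxisCone`, trivial apex inside `z = 0`, prepared). -/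
theorem apexFree_slice [Infinite k] (hcz : c (Fin.last n) ≠ 0) (hlev1 : AxisPolyhedron.AboveLevel d (m + 1) 1 g)
    (hcone : AxisPolyhedron.AxisCone d g) (hapex : AxisPolyhedron.TrivialApexX d g)
    (hprep : AxisPolyhedron.PreparedAxis d g)
    (hline : ∃ E : Fin (n + 1) →₀ ℕ, AxisPolyhedron.xDeg E < d ∧
      E (Fin.last n) = (m + 1) * (d - AxisPolyhedron.xDeg E) ∧ MvPowerSeries.coeff E g ≠ 0)
    (u : Fin (n + 1) → k) (hu : u ≠ 0) :
    ∃ v : Fin (n + 1) → k,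
      CobordantChart.initEval (fun _ : Fin (n + 1) => 1) (v + u) d (MvPowerSeries.subst (fun j : Fin (n + 2) =>
          if j = (Fin.last n).succ then (0 : MvPowerSeries (Fin (n + 1)) k)
          else MvPowerSeries.X (Fin.predAbove (Fin.last n) j)) G) ≠
        CobordantChart.initEval (fun _ : Fin (n + 1) => 1) v d (MvPowerSeries.subst (fun j : Fin (n + 2) =>
          if j = (Fin.last n).succ then (0 : MvPowerSeries (Fin (n + 1)) k)
          else MvPowerSeries.X (Fin.predAbove (Fin.last n) j)) G) := by
  by_contra hall
  push Not at hall
  set Sl := MvPowerSeries.subst (fun j : Fin (n + 2) =>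
    if j = (Fin.last n).succ then (0 : MvPowerSeries (Fin (n + 1)) k)
    else MvPowerSeries.X (Fin.predAbove (Fin.last n) j)) G with hSl
  -- `u = (u_s, u')`
  set u' : Fin n → k := Fin.tail u with hu'
  have hucons : u = Fin.cons (u 0) u' := (Fin.cons_self_tail u).symm
  by_cases hus : u 0 = 0
  · -- `u_s = 0`: `u' ≠ 0` is in the apex of `F`
    have hu'0 : u' ≠ 0 := by
      intro h
      apply hu
      rw [hucons, hus, h]
      funext i
      refine Fin.cases ?_ (fun j => ?_) i
      · simp
      · simp
    obtain ⟨v', hv'⟩ := hapex u' hu'0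
    apply hv'
    rw [snoc_add_snoc, ← initEval_slice_cons_zero hw1 hwm hm hfac hc' hcone,
      ← initEval_slice_cons_zero hw1 hwm hm hfac hc' hcone, ← hSl]
    have hadd : (Fin.cons 0 (v' + u') : Fin (n + 1) → k) = Fin.cons 0 v' + u := by
      rw [hucons, hus]
      funext i
      refine Fin.cases ?_ (fun j => ?_) i
      · simp
      · simp
    rw [hadd]
    exact hall _
  · -- `u_s ≠ 0`: `Γ(1, y') = F(y' - u'/u_s)`, so `-u'/(u_s c_z^{m+1})` solves the level-`(m+1)` vertex
    set γ : Fin n → k := (u 0)⁻¹ • u' with hγ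
    have hkey : ∀ v' : Fin n → k,
        CobordantChart.initEval (fun _ : Fin (n + 1) => 1) (Fin.cons 1 v' : Fin (n + 1) → k) d Sl =
          CobordantChart.initEval (fun _ : Fin (n + 1) => 1) (Fin.snoc (v' - γ) 0 : Fin (n + 1) → k) d g := by
      intro v'
      have h := initEval_add_smul_eq hall (-(u 0)⁻¹) (Fin.cons 1 v')
      have hpt : (Fin.cons 1 v' : Fin (n + 1) → k) + (-(u 0)⁻¹) • u = Fin.cons 0 (v' - γ) := by
        rw [hucons]
        funext i
        refine Fin.cases ?_ (fun j => ?_) i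
        · simp only [Pi.add_apply, Pi.smul_apply, Fin.cons_zero, smul_eq_mul]
          rw [neg_mul, inv_mul_cancel₀ hus, add_neg_cancel]
        · simp only [Pi.add_apply, Pi.smul_apply, Fin.cons_zero, Fin.cons_succ, smul_eq_mul, Pi.sub_apply, hγ]
          ring
      rw [← h, hpt, hSl, initEval_slice_cons_zero hw1 hwm hm hfac hc' hcone]
    -- the hypothesis of the Taylor identification at level `m + 1`, `t = c_z`
    have hsol := solvable_of_eval (d := d) (M := m + 1) (g := g) (t := c (Fin.last n)) hcz (γ := γ) hlev1 fun v' => by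
      have h := hkey v'
      rw [initEval_snoc_zero hcone, hSl, initEval_slice hw1 hwm hm hfac hc', sum_belowSucc] at h
      simp only [Fin.cons_zero, one_pow, one_mul, Fin.cons_succ, Pi.sub_apply] at h
      rw [← h]
      congr 1
      refine Finset.sum_congr rfl fun b hb => ?_
      rw [mem_antidiag_iff_degree] at hb
      rw [hb, Nat.sub_self, mul_zero, pow_zero, mul_one]
    by_cases hu'0 : u' = 0
    · -- `u' = 0`: the solving vector is `0`, so the level-`(m+1)` line is empty
      obtain ⟨E, hEx, hEz, hEg⟩ := hline
      apply hEg
      rw [hsol.2 E hEx hEz, hγ, hu'0, smul_zero, neg_zero, smul_zero, taylorCoeff_eq_sum]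
      refine Finset.sum_eq_zero fun b hb => ?_
      rw [mem_antidiag_iff_degree] at hb
      have hne : (Finsupp.equivFunOnFinite.symm fun j : Fin n => E (Fin.castSucc j)) ≠ b := by
        intro h
        rw [xDeg_eq_degree_xPart, h, hb] at hEx
        exact lt_irrefl d hEx
      obtain ⟨j, hj⟩ := ApexFreeOrderDrop.exists_apply_lt (e := Finsupp.equivFunOnFinite.symm fun j : Fin n =>
        E (Fin.castSucc j)) (β := b) (by rw [← xDeg_eq_degree_xPart, hb]; exact hEx.le) hne
      rw [Finsupp.coe_equivFunOnFinite_symm] at hj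
      rw [Finset.prod_eq_zero (Finset.mem_univ j) (by
        rw [Pi.zero_apply, zero_pow (Nat.sub_ne_zero_of_lt hj), mul_zero]), mul_zero]
    · -- `u' ≠ 0`: a non-zero solving vector, against `PreparedAxis`
      refine hprep (m + 1) _ ?_ hsol
      intro h0
      apply hu'0
      have h1 : (c (Fin.last n) ^ (m + 1))⁻¹ ≠ 0 := inv_ne_zero (pow_ne_zero _ hcz)
      have h2 := (smul_eq_zero.mp h0).resolve_left h1
      rw [neg_eq_zero, hγ] at h2
      exact (smul_eq_zero.mp h2).resolve_left (inv_ne_zero hus)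

end AxisPoint

end AxisWeightedMove

end Summit.ResolutionOfSingularities.ResolutionOfSingularities.Theorems
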